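import Literature.Probability.Percolation.QuadCrossingSpace
import HarnessLib

/-!
# The longitudinal squeeze at side 0 stays below a strictly dominated quad

Helper for crux stmt-CriticalPhenomena-10268 (`LagHandOff`, line `hitting-tournament`), registered
stub `stub_kernel_quadSqueeze_side0` (M1) — one half of the configuration-free "no-mushroom"
inclusion behind the kernel stubs of the crux (Camia–Newman 2007, Lemma 7.4, with Schramm–Smirnov
continuity in place of Cardy's formula).

Data.  A quad `Q₀ ∈ 𝒬_ℂ` (Schramm–Smirnov, `Quad univ`) and its **longitudinal squeeze at side 0**
`Q₁ = Q₀ ∘ σ_s`, `σ_s (t, u) = (s + (1 - s) t, u)` (`0 < s < 1`), i.e. the sub-quad of `Q₀`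
obtained by discarding the strip `Q₀ ([0, s) × [0, 1])` along `∂₀ Q₀`; a STEM (an open path from
within `o(1)` of `∂₀ Q₀` to `∂₂ Q₀`) is a crossing of `Q₁`.

Statement (`stub_kernel_quadSqueeze_side0`).  If `Q' < Q₀` then there is `s₀ > 0` such that for
all `0 < s < s₀` every quad `Q₁` with `Q₁ p = Q₀ (σ_s p)` satisfies `Q' ≤ Q₁` (every crossing of
`Q₁` contains a crossing of `Q'`).

Proof (pure topology of the quad space).  By the printed form of `<`
(`Quad.strictlyDominated_iff`) there are open `U₁ ∋ Q'`, `U₂ ∋ Q₀` with `Q ≤ Q''` for all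
`Q ∈ U₁`, `Q'' ∈ U₂`; `U₂` contains a ball `B(Q₀, r)` of the uniform metric, and
`d(Q₁, Q₀) = sup_p |Q₀ (σ_s p) − Q₀ p| < r` once `s` is small, because `dist (σ_s p, p) ≤ s`
(`dist_squeezeSide0_le`) and `Q₀` is uniformly continuous on the compact square.

References: O. Schramm, S. Smirnov, Ann. Probab. 39 (2011), §1.3 [SchrammSmirnov2011];
F. Camia, C. M. Newman, Probab. Theory Related Fields 139 (2007), Lemma 7.4 [CamiaNewman2007PTRF].
-/

noncomputable section

open Set Metric Filter Topology
open scoped unitInterval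
open Literature.Probability.Percolation Literature.Probability.Percolation.QuadCrossing

namespace Summit.CriticalPhenomena.CardyFormulaZ2.Cruxes.LagHandOff.HittingTournament

/-! ### The squeeze map moves points by at most `s` -/

/-- For `0 ≤ s ≤ 1` and `p = (t, u) ∈ [0,1]²`, the squeezed point `σ_s p = (s + (1 - s) t, u)`
(the first coordinate clamped to `[0,1]` by `Set.projIcc`, a no-op here) is within `s` of `p`:
`|s + (1 - s) t − t| = s (1 − t) ≤ s`. [folklore] -/
theorem dist_squeezeSide0_le {s : ℝ} (hs : 0 ≤ s) (hs1 : s ≤ 1) (p : I × I) :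
    dist ((Set.projIcc (0 : ℝ) 1 zero_le_one (s + (1 - s) * (p.1 : ℝ)), p.2) : I × I) p ≤ s := by
  have ht0 : 0 ≤ (p.1 : ℝ) := p.1.2.1
  have ht1 : (p.1 : ℝ) ≤ 1 := p.1.2.2
  have hmem : s + (1 - s) * (p.1 : ℝ) ∈ Set.Icc (0 : ℝ) 1 := by
    constructor <;> nlinarith
  rw [Set.projIcc_of_mem _ hmem, Prod.dist_eq, dist_self]
  refine max_le ?_ hs
  rw [Subtype.dist_eq, Real.dist_eq, abs_le]
  constructor <;> nlinarith

/-! ### The registered stub -/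

/-- **The longitudinal squeeze at side 0 stays below a strictly dominated quad** (registered stub
M1 of the crux `LagHandOff`, line `hitting-tournament`).  If `Q' < Q₀` in Schramm–Smirnov's quad
space `𝒬_ℂ`, then there is `s₀ > 0` such that for all `0 < s < s₀`, every quad `Q₁` parametrised
by `Q₁ (t, u) = Q₀ (s + (1 - s) t, u)` satisfies `Q' ≤ Q₁`: every crossing of the squeezed quad
contains a crossing of `Q'`.  (From the definition of `<` as the interior of `≤` and the uniform
continuity of `Q₀` on the square: `d(Q₁, Q₀) ≤ sup_p |Q₀ (σ_s p) − Q₀ p| → 0` as `s → 0`.)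
[cite: SchrammSmirnov2011, §1.3] -/
theorem stub_kernel_quadSqueeze_side0 :
    ∀ (Q' Q₀ : Quad (Set.univ : Set ℂ)), Quad.StrictlyDominated Q' Q₀ →
      ∃ s₀ : ℝ, 0 < s₀ ∧ ∀ s : ℝ, 0 < s → s < s₀ → ∀ Q₁ : Quad (Set.univ : Set ℂ),
        (∀ p : I × I, Q₁ p = Q₀ (Set.projIcc (0 : ℝ) 1 zero_le_one (s + (1 - s) * (p.1 : ℝ)), p.2)) →
        Quad.Dominated Q' Q₁ := by
  intro Q' Q₀ h
  obtain ⟨U₁, U₂, -, hU₂, h₁, h₂, hdom⟩ := Quad.strictlyDominated_iff.1 h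
  obtain ⟨r, hr, hball⟩ := Metric.isOpen_iff.1 hU₂ Q₀ h₂
  obtain ⟨δ, hδ, hUC⟩ := Metric.uniformContinuous_iff.1
    (CompactSpace.uniformContinuous_of_continuous Q₀.continuous_toFun) r hr
  refine ⟨min δ 1, lt_min hδ one_pos, fun s hs hs₀ Q₁ hQ₁ => hdom Q' h₁ Q₁ (hball ?_)⟩
  have hsδ : s < δ := hs₀.trans_le (min_le_left _ _)
  have hs1 : s ≤ 1 := (hs₀.trans_le (min_le_right _ _)).le
  rw [Metric.mem_ball, Quad.dist_eq, ContinuousMap.dist_lt_iff hr]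
  intro p
  rw [Quad.toContinuousMap_apply, Quad.toContinuousMap_apply, hQ₁ p]
  exact hUC ((dist_squeezeSide0_le hs.le hs1 p).trans_lt hsδ)

end Summit.CriticalPhenomena.CardyFormulaZ2.Cruxes.LagHandOff.HittingTournament

end
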